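import Summits.QuantumFields.BalabanUV.T4Continuum.Support.NE7TangentCriticalCover
import Summits.QuantumFields.BalabanUV.T4Continuum.Support.MinimalActionClassSixNeg
import HarnessLib

/-!
# NE7CentralTwist — MULTIPLYING A CONFIGURATION BY CENTRAL CONSTANTS `V ↦ V·z` (one scalar unitary per direction) changes NOTHING
# that the (APE) END sees except the block averages, which pick up `z^{L}` per level: plaquette variables, the dressed curl, the first
# variation, [B7] (42)'s loop variables and exponent, the differential of the average and the whole linearised tower are INVARIANT;
# `cavgIter L j (V·z) = (cavgIter L j V)·z^{L^j}`

Cell `pub-balaban`, rung (B)+1 sub-cell t4, lineage `b2b-balaban-t4-ne7-p2`, generation 89 (CRUX PROVER NE7 #2 = co-owner of row NE7, kernel hand); file (C4)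
of the gen-89 line «the (APE) END along the FLAT STRATUM by the cover trick».
WHY.  (D9) `NE7ApeFlatToronEnd` reaches the fibres over flat data `1^{w}` whose holonomy constants `h_i` have FINITE ORDER (`w` becomes periodic on a
cover).  The CENTRAL part of a holonomy constant is invisible to everything adjoint (`Ad`, the dressed curl, the tangent map) and is ABSORBED by
multiplying the fine configuration by constant scalars `z_μ = e^{a_μ}·1`: `cavgIter L (k+1) (U·z) = (cavgIter L (k+1) U)·z^{M}` (`M = L^{k+1}`), so a datum
whose `(N·m)`-fold axis holonomies are SCALARS `c_i·1` (instead of `1`) is brought to D9's intrinsic form by `a_i = −log c_i∕(N·m·M)`, while plaquettes,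
criticality and the class radii of `U` are untouched.  This file is the bookkeeping; its consumer is (D11) `NE7ApeFlatToronCentralEnd` (holonomy of finite
order MODULO THE CENTRE).
WHAT ([folklore]; 0 def, 0 sorry; the twisted configuration is written out as `fun x μ => V x μ * Z x μ`).  §1 CENTRAL-VALUED FACTORS `Z` (`∀ x μ X,
Z(x,μ)·X = X·Z(x,μ)`): `inv_central`, `units_comm_of_central`, `stepHol_mul_central`, `central_stepHol`, `central_hol`, **`hol_mul_central`** (`(V·Z)(Γ) =
V(Γ)·Z(Γ)`), `Ad_central`, `Ad_mul_central_right∕left`, **`curlAt_mul_central`**, `curl_mul_central`, `vary_mul_central`, `dstep_mul_central`, **`dhol_mul_central`**;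
with `Z` FLAT on plaquettes: `hol_plaqWord_mul_central`, `fhol_mul_central_flat`, `smallField_mul_central_iff`, **`dAction_mul_central`**.  §2 CONSTANT SCALARS
`Z = scalarCfg (fun _ μ => a μ)`: `central_scalarCfg`, `asum_const_base`, `hol_scalarConst_plaqWord`, `hol_scalarConst_seg`, `Wcx_scalarConst`,
**`Wcx_mul_scalarConst`**, `Xavg_mul_scalarConst`, **`bavg_mul_scalarConst`** (`= bavg V · e^{L a}`), `cavg_mul_scalarConst`, **`cavgIter_mul_scalarConst`**,
`mlogDeriv_mul_scalarConst`, `XavgDeriv_mul_scalarConst`, `sideDeriv_mul_scalarConst`, **`pushDir_mul_scalarConst`**, `cpush_mul_scalarConst`,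
**`dirIter_mul_scalarConst`**; §3 classes: `isUnitaryCfg_mul_scalarConst_imag`, `isPeriodicCfg_mul_scalarConst`.
HONEST FRAMING (page 1): elementary lattice bookkeeping over [B7] (8), (9), (42) BY NAME; nothing of Bałaban's asserted; moves no letter by itself; (APE) on
the data class NOT proved; NE7 NOT PRINTED ∕ NOT PROVED; spine PROVED 0∕9; FIXED FINITE T⁴, rung (B)+1 — NOT infinite volume, NOT mass gap, NOT BetaPertH, NOT
Clay.  Continuum YM on T⁴ ⇐ BetaPertH ∧ nine spine estimates (0/9 proved); BetaPertH ⇐ (D1) ∧ (D4) ∧ CAP+tail; G-an2-4 gates asym, D1 and NE2/3/4.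
-/

set_option autoImplicit false

open scoped BigOperators Matrix.Norms.L2Operator
open NormedSpace Finset

namespace Summit.QuantumFields.BalabanUV.T4Continuum.NE7CentralTwist

open Literature.MathematicalPhysics.QuantumFieldTheory.Balaban1983to89
open B7Prop1Explicit B7Prop2Explicit UnitaryModel
open T4AveragingDeficitWall (IsUnitaryCfg IsSkewDir SmallField Ad curl curlAt fhol vary nReTrL nReTrL_apply)
open T4AveragingDeficitWallBoundary (IsPeriodicCfg scalarCfg hol_scalarCfg val_hol_scalarCfg val_Wcx_scalarCfg)
open T4AveragingDeficitNonAbelian (Ad_mul)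
open AveragingDeficitPeriodicCounting (IsPeriodicDir)
open AveragingDeficitChartCalculus (cavg)
open AveragingDeficitMultiLevelPrep (cpush cavgIter)
open AveragingDeficitResidualPairing (pushDir)
open AveragingDeficitTransport (dstep dhol dhol_cons)
open AveragingDeficitSideDeriv (mlogDeriv XavgDeriv sideDeriv jexp)
open NE3HessForm (dAction)
open NE3TangentCovariantTower (dirIter dirIter_succ)
open MinimalActionClassSixNeg (isUnitaryCfg_scalarCfg_imag)
open FederbushMean (cexp_smul_one)

noncomputable section

variable {d : ℕ} {n : Type*} [Fintype n] [DecidableEq n]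

/-! ## §1 Central-valued factors -/

section Central

variable {V Z : Site d → Fin d → (Matrix n n ℂ)ˣ}

/-- The inverse of a central unit is central. [folklore] -/
theorem inv_central {z : (Matrix n n ℂ)ˣ} (hz : ∀ X : Matrix n n ℂ, (z : Matrix n n ℂ) * X = X * z) (X : Matrix n n ℂ) :
    ((z⁻¹ : (Matrix n n ℂ)ˣ) : Matrix n n ℂ) * X = X * ((z⁻¹ : (Matrix n n ℂ)ˣ) : Matrix n n ℂ) := by
  have h := hz (((z⁻¹ : (Matrix n n ℂ)ˣ) : Matrix n n ℂ) * X * ((z⁻¹ : (Matrix n n ℂ)ˣ) : Matrix n n ℂ))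
  rw [← mul_assoc, ← mul_assoc, Units.mul_inv, one_mul, mul_assoc, mul_assoc, Units.inv_mul, mul_one] at h
  exact h.symm

/-- A central unit commutes with every unit. [folklore] -/
theorem units_comm_of_central {z : (Matrix n n ℂ)ˣ} (hz : ∀ X : Matrix n n ℂ, (z : Matrix n n ℂ) * X = X * z) (u : (Matrix n n ℂ)ˣ) :
    z * u = u * z := Units.ext (hz u)

/-- One step of transport of `V·Z`: `stepHol (V·Z) = stepHol V · stepHol Z` (for the backward letter the inverse reorders thanks to centrality).
[cite: Balaban1985Averaging, (9) p.18] -/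
theorem stepHol_mul_central (hZ : ∀ (x : Site d) (μ : Fin d) (X : Matrix n n ℂ), (Z x μ : Matrix n n ℂ) * X = X * Z x μ)
    (x : Site d) (l : Letter d) :
    stepHol (fun y μ => V y μ * Z y μ) x l = stepHol V x l * stepHol Z x l := by
  obtain ⟨μ, b⟩ := l
  cases b
  · rw [stepHol_false, stepHol_false, stepHol_false, mul_inv_rev]
    exact (units_comm_of_central (inv_central (hZ _ μ)) _)
  · rfl

/-- The steps of a central-valued configuration are central. [folklore] -/
theorem central_stepHol (hZ : ∀ (x : Site d) (μ : Fin d) (X : Matrix n n ℂ), (Z x μ : Matrix n n ℂ) * X = X * Z x μ)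
    (x : Site d) (l : Letter d) (X : Matrix n n ℂ) :
    ((stepHol Z x l : (Matrix n n ℂ)ˣ) : Matrix n n ℂ) * X = X * ((stepHol Z x l : (Matrix n n ℂ)ˣ) : Matrix n n ℂ) := by
  obtain ⟨μ, b⟩ := l
  cases b
  · rw [stepHol_false]; exact inv_central (hZ _ μ) X
  · exact hZ x μ X

/-- The transports of a central-valued configuration are central. [folklore] -/
theorem central_hol (hZ : ∀ (x : Site d) (μ : Fin d) (X : Matrix n n ℂ), (Z x μ : Matrix n n ℂ) * X = X * Z x μ) :
    ∀ (x : Site d) (w : List (Letter d)) (X : Matrix n n ℂ),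
      ((hol Z x w : (Matrix n n ℂ)ˣ) : Matrix n n ℂ) * X = X * ((hol Z x w : (Matrix n n ℂ)ˣ) : Matrix n n ℂ)
  | x, [], X => by simp
  | x, l :: w, X => by
      rw [hol_cons, Units.val_mul, mul_assoc, central_hol hZ (x + l.vec) w X, ← mul_assoc, central_stepHol hZ x l X, mul_assoc]

/-- **TRANSPORT OF `V·Z` FOR CENTRAL `Z`**: `(V·Z)(Γ) = V(Γ)·Z(Γ)`. [cite: Balaban1985Averaging, (9) p.18] -/
theorem hol_mul_central (hZ : ∀ (x : Site d) (μ : Fin d) (X : Matrix n n ℂ), (Z x μ : Matrix n n ℂ) * X = X * Z x μ) :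
    ∀ (x : Site d) (w : List (Letter d)), hol (fun y μ => V y μ * Z y μ) x w = hol V x w * hol Z x w
  | x, [] => by simp
  | x, l :: w => by
      rw [hol_cons, hol_cons, hol_cons, stepHol_mul_central hZ, hol_mul_central hZ (x + l.vec) w]
      have hc : stepHol Z x l * hol V (x + l.vec) w = hol V (x + l.vec) w * stepHol Z x l :=
        units_comm_of_central (central_stepHol hZ x l) _
      rw [mul_assoc, ← mul_assoc (stepHol Z x l), hc, mul_assoc, mul_assoc]

/-- `Ad` of a central unit is the identity. [folklore] -/
theorem Ad_central {z : (Matrix n n ℂ)ˣ} (hz : ∀ X : Matrix n n ℂ, (z : Matrix n n ℂ) * X = X * z) (X : Matrix n n ℂ) : Ad z X = X := by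
  unfold Ad
  rw [hz X, mul_assoc, Units.mul_inv, mul_one]

/-- `Ad_{u·z} = Ad_u` for central `z`. [folklore] -/
theorem Ad_mul_central_right (u : (Matrix n n ℂ)ˣ) {z : (Matrix n n ℂ)ˣ} (hz : ∀ X : Matrix n n ℂ, (z : Matrix n n ℂ) * X = X * z)
    (X : Matrix n n ℂ) : Ad (u * z) X = Ad u X := by
  rw [Ad_mul, Ad_central hz]

/-- `Ad_{z·u} = Ad_u` for central `z`. [folklore] -/
theorem Ad_mul_central_left (u : (Matrix n n ℂ)ˣ) {z : (Matrix n n ℂ)ˣ} (hz : ∀ X : Matrix n n ℂ, (z : Matrix n n ℂ) * X = X * z)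
    (X : Matrix n n ℂ) : Ad (z * u) X = Ad u X := by
  rw [Ad_mul, Ad_central hz]

/-- **THE DRESSED CURL IS BLIND TO CENTRAL FACTORS**: `curlAt (V·Z) ψ = curlAt V ψ`. [folklore] -/
theorem curlAt_mul_central (hZ : ∀ (x : Site d) (μ : Fin d) (X : Matrix n n ℂ), (Z x μ : Matrix n n ℂ) * X = X * Z x μ)
    (ψ : Site d → Fin d → Matrix n n ℂ) (z : Site d) (μ ν : Fin d) :
    curlAt (fun y κ => V y κ * Z y κ) ψ z μ ν = curlAt V ψ z μ ν := by
  have h1 : ∀ X, Ad (V z μ * Z z μ) X = Ad (V z μ) X := fun X => Ad_mul_central_right _ (hZ z μ) X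
  have h2 : ∀ X, Ad (V z μ * Z z μ * (V (z + e μ) ν * Z (z + e μ) ν)) X = Ad (V z μ * V (z + e μ) ν) X := by
    intro X
    rw [Ad_mul, h1, Ad_mul_central_right _ (hZ _ ν), ← Ad_mul]
  have h3 : ∀ X, Ad (V z μ * Z z μ * (V (z + e μ) ν * Z (z + e μ) ν) * (V (z + e ν) μ * Z (z + e ν) μ)⁻¹) X
      = Ad (V z μ * V (z + e μ) ν * (V (z + e ν) μ)⁻¹) X := by
    intro X
    rw [Ad_mul, mul_inv_rev, Ad_mul_central_left _ (inv_central (hZ _ μ)), h2, ← Ad_mul]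
  simp only [curlAt, h1, h2, h3]

/-- The dressed curl on indexed plaquettes is blind to central factors. [folklore] -/
theorem curl_mul_central (hZ : ∀ (x : Site d) (μ : Fin d) (X : Matrix n n ℂ), (Z x μ : Matrix n n ℂ) * X = X * Z x μ)
    (ψ : Site d → Fin d → Matrix n n ℂ) (p : T4AveragingDeficitWall.Plaq d) :
    curl (fun y κ => V y κ * Z y κ) ψ p = curl V ψ p :=
  curlAt_mul_central hZ ψ p.1 p.2.1.1 p.2.1.2

/-- The perturbation of `V·Z` along `ψ` is the perturbation of `V` times `Z`: `(V·Z)e^{sψ} = (V e^{sψ})·Z`. [folklore] -/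
theorem vary_mul_central (hZ : ∀ (x : Site d) (μ : Fin d) (X : Matrix n n ℂ), (Z x μ : Matrix n n ℂ) * X = X * Z x μ)
    (ψ : Site d → Fin d → Matrix n n ℂ) (s : ℝ) :
    vary (fun y κ => V y κ * Z y κ) ψ s = fun y κ => vary V ψ s y κ * Z y κ := by
  funext y κ
  simp only [vary]
  rw [mul_assoc, mul_assoc, units_comm_of_central (hZ y κ)]

/-- The linearised step is blind to central factors. [folklore] -/
theorem dstep_mul_central (hZ : ∀ (x : Site d) (μ : Fin d) (X : Matrix n n ℂ), (Z x μ : Matrix n n ℂ) * X = X * Z x μ)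
    (ψ : Site d → Fin d → Matrix n n ℂ) (x : Site d) (l : Letter d) :
    dstep (fun y κ => V y κ * Z y κ) ψ x l = dstep V ψ x l := by
  obtain ⟨μ, b⟩ := l
  cases b
  · rfl
  · simp only [dstep, ↓reduceIte]
    exact Ad_mul_central_right _ (hZ x μ) _

/-- **THE LINEARISED TRANSPORT IS BLIND TO CENTRAL FACTORS**: `dhol (V·Z) ψ = dhol V ψ`. [folklore] -/
theorem dhol_mul_central (hZ : ∀ (x : Site d) (μ : Fin d) (X : Matrix n n ℂ), (Z x μ : Matrix n n ℂ) * X = X * Z x μ)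
    (ψ : Site d → Fin d → Matrix n n ℂ) : ∀ (x : Site d) (w : List (Letter d)), dhol (fun y κ => V y κ * Z y κ) ψ x w = dhol V ψ x w
  | x, [] => by simp
  | x, l :: w => by
      rw [dhol_cons, dhol_cons, dstep_mul_central hZ, dhol_mul_central hZ ψ (x + l.vec) w, stepHol_mul_central hZ,
        Ad_mul_central_right _ (central_stepHol hZ x l)]

/-- With `Z` flat on plaquettes, the plaquette variables of `V·Z` are those of `V`. [folklore] -/
theorem hol_plaqWord_mul_central (hZ : ∀ (x : Site d) (μ : Fin d) (X : Matrix n n ℂ), (Z x μ : Matrix n n ℂ) * X = X * Z x μ)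
    (hZflat : ∀ (x : Site d) (κ κ' : Fin d), hol Z x (plaqWord κ κ') = 1) (x : Site d) (κ κ' : Fin d) :
    hol (fun y μ => V y μ * Z y μ) x (plaqWord κ κ') = hol V x (plaqWord κ κ') := by
  rw [hol_mul_central hZ, hZflat, mul_one]

/-- `fhol (V·Z) = fhol V` for central flat `Z`. [folklore] -/
theorem fhol_mul_central_flat (hZ : ∀ (x : Site d) (μ : Fin d) (X : Matrix n n ℂ), (Z x μ : Matrix n n ℂ) * X = X * Z x μ)
    (hZflat : ∀ (x : Site d) (κ κ' : Fin d), hol Z x (plaqWord κ κ') = 1) (p : T4AveragingDeficitWall.Plaq d) :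
    fhol (fun y μ => V y μ * Z y μ) p = fhol V p :=
  hol_plaqWord_mul_central hZ hZflat p.1 p.2.1.1 p.2.1.2

/-- The small-field class does not see central flat factors. [folklore] -/
theorem smallField_mul_central_iff (hZ : ∀ (x : Site d) (μ : Fin d) (X : Matrix n n ℂ), (Z x μ : Matrix n n ℂ) * X = X * Z x μ)
    (hZflat : ∀ (x : Site d) (κ κ' : Fin d), hol Z x (plaqWord κ κ') = 1) (a : ℝ) :
    SmallField (fun y μ => V y μ * Z y μ) a ↔ SmallField V a := by
  constructor
  · intro h x κ κ' hκ
    have h' := h x κ κ' hκ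
    rwa [hol_plaqWord_mul_central hZ hZflat] at h'
  · intro h x κ κ' hκ
    rw [hol_plaqWord_mul_central hZ hZflat]
    exact h x κ κ' hκ

/-- **THE FIRST VARIATION IS BLIND TO CENTRAL FLAT FACTORS**: `dAction (V·Z) ψ W = dAction V ψ W`. [folklore] -/
theorem dAction_mul_central (hZ : ∀ (x : Site d) (μ : Fin d) (X : Matrix n n ℂ), (Z x μ : Matrix n n ℂ) * X = X * Z x μ)
    (hZflat : ∀ (x : Site d) (κ κ' : Fin d), hol Z x (plaqWord κ κ') = 1) (ψ : Site d → Fin d → Matrix n n ℂ)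
    (W : Finset (T4AveragingDeficitWall.Plaq d)) :
    dAction (fun y μ => V y μ * Z y μ) ψ W = dAction V ψ W := by
  unfold dAction
  refine congrArg (fun t : ℝ => -t) (Finset.sum_congr rfl fun p _ => ?_)
  rw [curl_mul_central hZ, fhol_mul_central_flat hZ hZflat]

end Central

/-! ## §2 Constant scalar factors `z_μ = e^{a_μ}·1` -/

section Scalar

variable (V : Site d → Fin d → (Matrix n n ℂ)ˣ) (a : Fin d → ℂ)

/-- Scalar configurations are central-valued (`exp (c·1) = e^c·1` is the tree's `FederbushMean.cexp_smul_one`). [folklore] -/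
theorem central_scalarCfg (f : Site d → Fin d → ℂ) (x : Site d) (μ : Fin d) (X : Matrix n n ℂ) :
    (scalarCfg (n := n) f x μ : Matrix n n ℂ) * X = X * scalarCfg (n := n) f x μ := by
  simp only [scalarCfg, val_expUnit, ← cexp_smul_one, smul_mul_assoc, one_mul, mul_smul_comm, mul_one]

omit [Fintype n] [DecidableEq n] in
/-- The abelian path functional of CONSTANT exponents does not depend on the base point. [folklore] -/
theorem asum_const_base : ∀ (x y : Site d) (w : List (Letter d)),
    asum (fun (_ : Site d) (μ : Fin d) => a μ) x w = asum (fun (_ : Site d) (μ : Fin d) => a μ) y w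
  | x, y, [] => by simp
  | x, y, l :: w => by
      rw [asum_cons, asum_cons, asum_const_base (x + l.vec) (y + l.vec) w]
      obtain ⟨μ, b⟩ := l
      cases b <;> simp [stepA]

/-- The constant scalar configuration is flat: its plaquette variables are `1`. [folklore] -/
theorem hol_scalarConst_plaqWord (x : Site d) (κ κ' : Fin d) :
    hol (scalarCfg (n := n) (fun (_ : Site d) (μ : Fin d) => a μ)) x (plaqWord κ κ') = 1 := by
  rw [hol_scalarCfg, asum_plaqWord]
  have h0 : (a κ + a κ' - a κ - a κ' : ℂ) = 0 := by ring
  rw [h0, zero_smul]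
  exact T4AveragingDeficitWall.expUnit_zero

/-- The straight transport of the constant scalar configuration: `z([p, p + L e_κ]) = e^{L a_κ}·1`. [folklore] -/
theorem hol_scalarConst_seg (p : Site d) (κ : Fin d) (L : ℕ) :
    hol (scalarCfg (n := n) (fun (_ : Site d) (μ : Fin d) => a μ)) p (seg κ (L : ℤ))
      = expUnit ((((L : ℂ) * a κ)) • (1 : Matrix n n ℂ)) := by
  rw [hol_scalarCfg, asum_seg_natCast]
  simp [Finset.sum_const, Finset.card_range, nsmul_eq_mul]

/-- [B7] (42)'s loop variable of the constant scalar configuration is `1` (the loop `Γ_{c,x} ∪ (−Γ_c)` has zero net displacement in every direction).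
[cite: Balaban1985Averaging, (42) p.23] -/
theorem Wcx_scalarConst (L : ℕ) (q : Site d) (κ : Fin d) (r : Site d) :
    Wcx L (scalarCfg (n := n) (fun (_ : Site d) (μ : Fin d) => a μ)) q κ r = 1 := by
  ext1
  rw [val_Wcx_scalarCfg, asum_gammaWord, asum_const_base a (q + (L : ℤ) • e κ) q (treeWord r),
    asum_const_base a (q + r) q (seg κ L)]
  simp

/-- **(42)'s LOOP VARIABLES ARE BLIND TO CONSTANT SCALAR FACTORS**: `Wcx L (V·z) = Wcx L V`. [cite: Balaban1985Averaging, (42) p.23] -/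
theorem Wcx_mul_scalarConst (L : ℕ) (q : Site d) (κ : Fin d) (r : Site d) :
    Wcx L (fun y μ => V y μ * scalarCfg (n := n) (fun (_ : Site d) (ν : Fin d) => a ν) y μ) q κ r = Wcx L V q κ r := by
  have hZ := central_scalarCfg (n := n) (fun (_ : Site d) (ν : Fin d) => a ν)
  have hW := Wcx_scalarConst (n := n) a L q κ r
  unfold Wcx at hW ⊢
  rw [hol_mul_central hZ, hol_mul_central hZ, mul_inv_rev]
  set A := hol V q (gammaWord L κ r)
  set B := hol (scalarCfg (n := n) fun (_ : Site d) (ν : Fin d) => a ν) q (gammaWord L κ r)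
  set C := hol V q (seg κ L)
  set D := hol (scalarCfg (n := n) fun (_ : Site d) (ν : Fin d) => a ν) q (seg κ L)
  have hDc : D⁻¹ * C⁻¹ = C⁻¹ * D⁻¹ := units_comm_of_central (inv_central (central_hol hZ q (seg κ L))) _
  have hBc : B * C⁻¹ = C⁻¹ * B := units_comm_of_central (central_hol hZ q (gammaWord L κ r)) _
  calc A * B * (D⁻¹ * C⁻¹) = A * B * (C⁻¹ * D⁻¹) := by rw [hDc]
    _ = A * (B * C⁻¹) * D⁻¹ := by simp only [mul_assoc]
    _ = A * (C⁻¹ * B) * D⁻¹ := by rw [hBc]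
    _ = A * C⁻¹ * (B * D⁻¹) := by simp only [mul_assoc]
    _ = A * C⁻¹ := by rw [hW, mul_one]

/-- (42)'s exponent is blind to constant scalar factors: `Xavg L (V·z) = Xavg L V`. [cite: Balaban1985Averaging, (42) p.23] -/
theorem Xavg_mul_scalarConst (L : ℕ) (q : Site d) (κ : Fin d) :
    Xavg L (fun y μ => V y μ * scalarCfg (n := n) (fun (_ : Site d) (ν : Fin d) => a ν) y μ) q κ = Xavg L V q κ := by
  unfold Xavg
  refine Finset.sum_congr rfl fun r _ => ?_
  rw [Wcx_mul_scalarConst]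

/-- **THE AVERAGE (42) OF `V·z` IS THE AVERAGE OF `V` TIMES `z^{L}`**: `bavg L (V·z)(q,κ) = bavg L V (q,κ) · e^{L a_κ}·1`.
[cite: Balaban1985Averaging, (42) p.23] -/
theorem bavg_mul_scalarConst (L : ℕ) (q : Site d) (κ : Fin d) :
    bavg L (fun y μ => V y μ * scalarCfg (n := n) (fun (_ : Site d) (ν : Fin d) => a ν) y μ) q κ
      = bavg L V q κ * scalarCfg (n := n) (fun (_ : Site d) (ν : Fin d) => (L : ℂ) * a ν) q κ := by
  have hZ := central_scalarCfg (n := n) (fun (_ : Site d) (ν : Fin d) => a ν)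
  unfold bavg
  rw [Xavg_mul_scalarConst, hol_mul_central hZ, hol_scalarConst_seg, mul_assoc]
  rfl

/-- On the coarse unit lattice: `cavg L (V·z) = (cavg L V)·z^{L}`. [folklore] -/
theorem cavg_mul_scalarConst (L : ℕ) :
    cavg L (fun y μ => V y μ * scalarCfg (n := n) (fun (_ : Site d) (ν : Fin d) => a ν) y μ)
      = fun y μ => cavg L V y μ * scalarCfg (n := n) (fun (_ : Site d) (ν : Fin d) => (L : ℂ) * a ν) y μ := by
  funext y μ
  exact bavg_mul_scalarConst V a L _ μ

end Scalar

/-- **THE `j`-FOLD AVERAGE OF `V·z` IS THE `j`-FOLD AVERAGE OF `V` TIMES `z^{L^j}`**. [folklore] -/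
theorem cavgIter_mul_scalarConst (L : ℕ) : ∀ (j : ℕ) (V : Site d → Fin d → (Matrix n n ℂ)ˣ) (a : Fin d → ℂ),
    cavgIter L j (fun y μ => V y μ * scalarCfg (n := n) (fun (_ : Site d) (ν : Fin d) => a ν) y μ)
      = fun y μ => cavgIter L j V y μ * scalarCfg (n := n) (fun (_ : Site d) (ν : Fin d) => ((L : ℂ) ^ j) * a ν) y μ
  | 0, V, a => by simp [cavgIter]
  | j + 1, V, a => by
      show cavgIter L j (cavg L _) = fun y μ => cavgIter L j (cavg L V) y μ * _
      rw [cavg_mul_scalarConst, cavgIter_mul_scalarConst L j (cavg L V)]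
      funext y μ
      congr 3
      funext _ ν
      rw [pow_succ]; ring

/-! ## §3 The differential of the average and the linearised tower -/

section Tangent

variable (V : Site d → Fin d → (Matrix n n ℂ)ˣ) (a : Fin d → ℂ)

/-- `(log W_s)′` is blind to constant scalar factors. [folklore] -/
theorem mlogDeriv_mul_scalarConst (L : ℕ) (ψ : Site d → Fin d → Matrix n n ℂ) (q : Site d) (κ : Fin d) (r : Site d) :
    mlogDeriv L (fun y μ => V y μ * scalarCfg (n := n) (fun (_ : Site d) (ν : Fin d) => a ν) y μ) ψ q κ r = mlogDeriv L V ψ q κ r := by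
  unfold mlogDeriv
  congr 1
  funext s
  rw [vary_mul_central (central_scalarCfg (n := n) (fun (_ : Site d) (ν : Fin d) => a ν)), Wcx_mul_scalarConst]

/-- `X_c′` is blind to constant scalar factors. [folklore] -/
theorem XavgDeriv_mul_scalarConst (L : ℕ) (ψ : Site d → Fin d → Matrix n n ℂ) (q : Site d) (κ : Fin d) :
    XavgDeriv L (fun y μ => V y μ * scalarCfg (n := n) (fun (_ : Site d) (ν : Fin d) => a ν) y μ) ψ q κ = XavgDeriv L V ψ q κ := by
  unfold XavgDeriv
  refine Finset.sum_congr rfl fun r _ => ?_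
  rw [mlogDeriv_mul_scalarConst]

/-- `δV̄(c)·V̄(c)⁻¹` is blind to constant scalar factors. [folklore] -/
theorem sideDeriv_mul_scalarConst (L : ℕ) (ψ : Site d → Fin d → Matrix n n ℂ) (q : Site d) (κ : Fin d) :
    sideDeriv L (fun y μ => V y μ * scalarCfg (n := n) (fun (_ : Site d) (ν : Fin d) => a ν) y μ) ψ q κ = sideDeriv L V ψ q κ := by
  unfold sideDeriv
  rw [Xavg_mul_scalarConst, XavgDeriv_mul_scalarConst,
    dhol_mul_central (central_scalarCfg (n := n) (fun (_ : Site d) (ν : Fin d) => a ν))]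

/-- **THE DIFFERENTIAL OF (42) IS BLIND TO CONSTANT SCALAR FACTORS**: `pushDir L (V·z) ψ = pushDir L V ψ`. [cite: Balaban1985Averaging, (42) p.23] -/
theorem pushDir_mul_scalarConst (L : ℕ) (ψ : Site d → Fin d → Matrix n n ℂ) (q : Site d) (κ : Fin d) :
    pushDir L (fun y μ => V y μ * scalarCfg (n := n) (fun (_ : Site d) (ν : Fin d) => a ν) y μ) ψ q κ = pushDir L V ψ q κ := by
  unfold pushDir
  rw [sideDeriv_mul_scalarConst, bavg_mul_scalarConst, mul_inv_rev,
    Ad_mul_central_left _ (inv_central (central_scalarCfg (n := n) (fun (_ : Site d) (ν : Fin d) => (L : ℂ) * a ν) q κ))]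

/-- `cpush L (V·z) = cpush L V`. [folklore] -/
theorem cpush_mul_scalarConst (L : ℕ) (ψ : Site d → Fin d → Matrix n n ℂ) :
    cpush L (fun y μ => V y μ * scalarCfg (n := n) (fun (_ : Site d) (ν : Fin d) => a ν) y μ) ψ = cpush L V ψ := by
  funext y κ
  exact pushDir_mul_scalarConst V a L ψ _ κ

end Tangent

/-- **THE WHOLE LINEARISED TOWER IS BLIND TO CONSTANT SCALAR FACTORS**: `dirIter L j (V·z) ψ = dirIter L j V ψ`. [folklore] -/
theorem dirIter_mul_scalarConst (L : ℕ) : ∀ (j : ℕ) (V : Site d → Fin d → (Matrix n n ℂ)ˣ) (a : Fin d → ℂ)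
    (ψ : Site d → Fin d → Matrix n n ℂ),
    dirIter L j (fun y μ => V y μ * scalarCfg (n := n) (fun (_ : Site d) (ν : Fin d) => a ν) y μ) ψ = dirIter L j V ψ
  | 0, V, a, ψ => rfl
  | j + 1, V, a, ψ => by
      rw [dirIter_succ, dirIter_succ, cpush_mul_scalarConst, cavg_mul_scalarConst]
      exact dirIter_mul_scalarConst L j (cavg L V) _ _

/-! ## §4 Unitarity and periodicity -/

/-- `V·z` is `U(n)`-valued for unitary `V` and purely imaginary exponents `a_μ = i·t_μ`. [folklore] -/
theorem isUnitaryCfg_mul_scalarConst_imag {V : Site d → Fin d → (Matrix n n ℂ)ˣ} (hV : IsUnitaryCfg V) (t : Fin d → ℝ) :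
    IsUnitaryCfg (fun y μ => V y μ * scalarCfg (n := n) (fun (_ : Site d) (ν : Fin d) => ((t ν : ℝ) : ℂ) * Complex.I) y μ) := by
  intro x κ
  exact (unitaryUnits (Matrix n n ℂ)).mul_mem (hV x κ) (isUnitaryCfg_scalarCfg_imag (n := n) (fun (_ : Site d) ν => t ν) x κ)

/-- `V·z` is `P`-periodic when `V` is (the factor is constant). [folklore] -/
theorem isPeriodicCfg_mul_scalarConst {V : Site d → Fin d → (Matrix n n ℂ)ˣ} {P : ℤ} (hV : IsPeriodicCfg V P) (a : Fin d → ℂ) :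
    IsPeriodicCfg (fun y μ => V y μ * scalarCfg (n := n) (fun (_ : Site d) (ν : Fin d) => a ν) y μ) P := by
  intro x κ μ
  simp only [hV x κ μ]
  rfl

end

end Summit.QuantumFields.BalabanUV.T4Continuum.NE7CentralTwist
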